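import Literature.NumberTheory.EllipticCurves.DegreeConjectureAbcMurtyProofs
import Literature.NumberTheory.EllipticCurves.SzpiroBGEquivalenceProofs
import Literature.NumberTheory.EllipticCurves.ModularCurveManinSemistableCoprimeFormProofs
import Literature.NumberTheory.Automorphic.ShimuraCurveRibetTakahashiPeterssonConvexityProofs
import Literature.NumberTheory.DiophantineGeometry.PastenValuationProductsProofs
import HarnessLib

/-!
# Murty's Theorem 1 (ii) for every elliptic curve over `ℚ`: `deg φ_D ≤ C_ε · c_D² · N^{2+ε}` under abc

Topic `Literature/NumberTheory/EllipticCurves` (family `abc`). A proofs-only complement (four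
theorems and one bookkeeping lemma; no definition, no named fact, nothing restated — D-0026) to
`DegreeConjectureAbcMurtyConverseProofs.lean`, which runs Murty's computation (*Bounds for
congruence primes*, 1999, §2) for every parametrisation datum of a FREY curve. Here the same
computation is run for every parametrisation datum `D` of EVERY elliptic curve over `ℚ` given by a
global minimal Weierstrass equation `W`, keeping the Manin constant `c_D` explicit:

* `modularDegree_le_maninSq_rpow_of_abcLe_of_petersson_of_isGloballyMinimal`: from the `≤`-form of
  the abc conjecture and a Petersson upper bound `(f,f) ≤ C₂ N^{1+θ}` for newforms of elliptic
  curves, `deg φ_D ≤ C(ε, θ) · c_D² · N^{2+θ+ε}` at the level `N = N_W` of every datum `D` of `W`;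
* `modularDegree_le_maninSq_of_abcLe_of_petersson_of_isGloballyMinimal`: the `ε`-form
  (`(f,f) ≪_η N^{1+η}` for every `η > 0` gives `N^{2+ε}`);
* `modularDegree_le_maninSq_of_abcLe_of_isSemistable`: for SEMISTABLE curves the Petersson input is
  a theorem of the tree (`(f,f) ≤ C · N · (1 + log N)⁵` for square-free `N`,
  `Literature.NumberTheory.Automorphic.exists_petersson_le_mul_log_pow_of_squarefree`), so abc ALONE
  gives `deg φ_D ≤ C_ε · c_D² · N^{2+ε}` for every datum of every semistable elliptic curve over `ℚ`
  in global minimal form (`…_of_isSemistable'`: the same with the level `N = N_W` of the datum as a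
  free variable). With a bounded Manin constant this is the modular-degree conjecture for
  semistable curves; the Manin constant is the only input of Murty's direction (ii) not supplied
  (Pasten 2024, Rem. 3.3).

On a Frey curve the height input of Murty's argument is immediate (`c₄`, `c₆` are polynomials in
`a, b`); for a general curve it is Frey's observation that abc implies the height conjecture,
in the tree as the PROVED equivalence "abc `≤`-form ⟺ generalised Szpiro
`max(|Δ_min|, |c₄|³) ≤ C_ε N^{6+ε}`" (`abcLe_iff_generalizedSzpiroBG_holds`, Bombieri–Gubler
Thm. 12.5.12). The rest is as in Murty, §2: Zagier's identity `4π² c² (f,f) = deg · covol(Λ)`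
(`zagier_degree_formula_holds`), Silverman's lower covolume inequality
`covol(Λ)^{−6} ≪ max(|c₄|³, |c₆|²)` (`covolume_rpow_neg_six_le_of_isNeronLatticeOf`),
`max(|c₄|³, |c₆|²) ≤ 1729 · max(|Δ|, |c₄|³)` (`max_abs_c₄_c₆_le` of `SzpiroProofs.lean`, from
`1728 Δ = c₄³ − c₆²`), and the bookkeeping lemmas `inv_le_of_rpow_neg_six_le`,
`deg_le_of_zagier_of_upper` of `DegreeConjectureAbcMurtyProofs.lean`; the one new bookkeeping lemma
is `log_add_one_pow_five_le` (`(log N + 1)⁵ ≪_θ N^θ`).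
All ingredients are theorems of the tree; the only hypotheses are abc and (for the first two
theorems) the Petersson upper bound.

## References

* M. R. Murty, *Bounds for congruence primes*, in: Automorphic Forms, Automorphic Representations,
  and Arithmetic (Fort Worth 1996), Proc. Sympos. Pure Math. 66.1, AMS (1999) 177–192: Thm. 1 (ii)
  and §2. [MurtyCongruencePrimes1999]
* G. Frey, *Links between solutions of `A − B = C` and elliptic curves*, in: Number Theory (Ulm
  1987), Lecture Notes in Math. 1380, Springer (1989) 31–62. [Frey1989]
* E. Bombieri, W. Gubler, *Heights in Diophantine Geometry*, CUP (2006): Thm. 12.5.12.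
  [BombieriGubler2006]
* H. Pasten, *Shimura curves and the abc conjecture*, J. Number Theory 254 (2024) 214–335 =
  arXiv:1705.09251: §3, Rem. 3.3. [PastenShimura2024]
-/

noncomputable section

open IsDedekindDomain WeierstrassCurve NumberField

namespace Literature.NumberTheory.EllipticCurves

open ModularForms CongruenceSubgroup

/-- `(log N + 1)⁵ ≤ (5/θ + 1)⁵ · N^θ` for `N ≥ 1`, `θ > 0` (from `log N ≤ N^η/η`, `η = θ/5`).
[folklore] -/
theorem log_add_one_pow_five_le {N θ : ℝ} (hN : 1 ≤ N) (hθ : 0 < θ) :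
    (Real.log N + 1) ^ 5 ≤ (5 / θ + 1) ^ 5 * N ^ θ := by
  have hη : 0 < θ / 5 := by positivity
  have h1 : Real.log N ≤ N ^ (θ / 5) / (θ / 5) := Real.log_le_rpow_div (by linarith) hη
  have h2 : (1 : ℝ) ≤ N ^ (θ / 5) := Real.one_le_rpow hN hη.le
  have h3 : Real.log N + 1 ≤ (5 / θ + 1) * N ^ (θ / 5) := by
    have : N ^ (θ / 5) / (θ / 5) = 5 / θ * N ^ (θ / 5) := by
      field_simp
    rw [this] at h1
    nlinarith
  have h0 : 0 ≤ Real.log N + 1 := by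
    have := Real.log_nonneg hN
    linarith
  have h5 : (N ^ (θ / 5)) ^ 5 = N ^ θ := by
    rw [← Real.rpow_natCast, ← Real.rpow_mul (by linarith)]
    norm_num
  calc (Real.log N + 1) ^ 5 ≤ ((5 / θ + 1) * N ^ (θ / 5)) ^ 5 :=
        pow_le_pow_left₀ h0 h3 5
    _ = (5 / θ + 1) ^ 5 * N ^ θ := by rw [mul_pow, h5]

/-- **Murty's Theorem 1 (ii) for every datum of every elliptic curve over `ℚ`, Manin constant
explicit, Petersson exponent `θ`.** Suppose `(f,f) ≤ C₂ N^{1+θ}` for the newform of every elliptic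
curve over `ℚ` (un-normalised Petersson norm on `Γ₀(N)`; hypothesis `hUp`) and the `≤`-form of the
abc conjecture. Then for every `ε > 0` there is `C` with `deg φ_D ≤ C · c_D² · N^{2+θ+ε}` for
every elliptic curve `W/ℚ` given by a global minimal Weierstrass equation, `N = N_W` its conductor,
and EVERY modular parametrisation datum `D` of `W` at level `N` (Manin constant `c_D`). Murty, §2:
`deg φ = 4π² c² (f,f) / covol(Λ)`; `covol(Λ)⁻¹ ≪ max(|c₄|³, |c₆|²)^{1/6}` (Silverman);
`max(|Δ|, |c₄|³, |c₆|²) ≪_ε N^{6+ε}` under abc (Frey; Bombieri–Gubler Thm. 12.5.12, tree theorem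
`abcLe_iff_generalizedSzpiroBG_holds`). No modularity and no bound on `c` is used.
[cite: MurtyCongruencePrimes1999, Thm. 1 (ii) and §2] [cite: BombieriGubler2006, Thm. 12.5.12] -/
theorem modularDegree_le_maninSq_rpow_of_abcLe_of_petersson_of_isGloballyMinimal {θ : ℝ}
    (hUp : ∃ C₂ : ℝ, ∀ (N : ℕ) [NeZero N] (W : WeierstrassCurve ℚ) [W.IsElliptic]
      (f : CuspForm (Gamma0 N) 2), IsNewformOf W f →
        (peterssonProduct (Gamma0 N) 2 f f).re ≤ C₂ * (N : ℝ) ^ (1 + θ))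
    (habc : ∀ ε : ℝ, 0 < ε → ∃ C : ℝ, ∀ a b c : ℕ, DiophantineGeometry.IsABCTriple a b c →
      (c : ℝ) ≤ C * ((DiophantineGeometry.rad a b c : ℕ) : ℝ) ^ (1 + ε)) :
    ∀ ε : ℝ, 0 < ε → ∃ C : ℝ, ∀ (W : WeierstrassCurve ℚ) [W.IsElliptic] [W.IsGloballyMinimal]
      (N : ℕ) [NeZero N], W.conductorNorm ℤ = N →
        ∀ D : ModularParametrizationData W N,
          (D.modularDegree : ℝ) ≤ C * (D.maninConstant : ℝ) ^ 2 * (N : ℝ) ^ (2 + θ + ε) := by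
  intro ε hε
  obtain ⟨C₂, hC₂⟩ := hUp
  -- abc ⟹ generalised Szpiro with exponent `6 + 6ε`
  have h6ε : 0 < 6 * ε := by positivity
  obtain ⟨Cσ, hCσ⟩ := abcLe_iff_generalizedSzpiroBG_holds.mp habc (6 * ε) h6ε
  obtain ⟨A, hA, hSil⟩ := covolume_rpow_neg_six_le_of_isNeronLatticeOf
  -- the constant
  set B : ℝ := A * (1729 * max Cσ 0) with hB
  have hB0 : 0 ≤ B := by positivity
  set K : ℝ := 4 * Real.pi ^ 2 * max C₂ 0 * B ^ (1 / 6 : ℝ) with hK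
  refine ⟨K, fun W _ _ N _ hN D ↦ ?_⟩
  have hNpos : (0 : ℝ) < N := by exact_mod_cast Nat.pos_of_ne_zero (NeZero.ne N)
  -- Zagier's identity `4π² c² (f,f) = deg · covol`
  have hZ := congrArg Complex.re D.zagier_degree_formula_holds
  rw [Complex.re_ofReal_mul, Complex.ofReal_re] at hZ
  have hP0 : 0 ≤ (peterssonProduct (Gamma0 N) 2 D.f D.f).re :=
    D.zagier_degree_formula_holds.peterssonProduct_re_pos.le
  have hcov : 0 < ZLattice.covolume D.L.lattice := ZLattice.covolume_pos _ _
  -- the Petersson upper bound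
  have hP : (peterssonProduct (Gamma0 N) 2 D.f D.f).re ≤ max C₂ 0 * (N : ℝ) ^ (1 + θ) :=
    (hC₂ N W D.f D.isNewformOf).trans
      (mul_le_mul_of_nonneg_right (le_max_left _ _) (by positivity))
  -- generalised Szpiro on the integral global minimal model `W₀`, `W₀ ⊗ ℚ = W`
  set W₀ : WeierstrassCurve ℤ := integralModelInt W with hW₀def
  have hW₀ : W₀.baseChange ℚ = W := baseChange_integralModelInt W
  have hell : (W₀.baseChange ℚ).IsElliptic := by rw [hW₀]; infer_instance
  have hmin : ∀ v : HeightOneSpectrum ℤ, (W₀.baseChange ℚ).IsMinimalAt v := fun v ↦ by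
    rw [hW₀]; exact IsGloballyMinimal.isMinimalAt_int W v
  have hσ := hCσ W₀ hell hmin
  rw [hW₀, hN] at hσ
  -- `max(|c₄|³,|c₆|²) ≤ 1729 · max(|Δ|,|c₄|³) ≤ 1729 · max Cσ 0 · N^{6+6ε}`
  have hmax : ((max (|W.c₄| ^ 3) (|W.c₆| ^ 2) : ℚ) : ℝ) ≤
      1729 * max Cσ 0 * (N : ℝ) ^ (6 + 6 * ε) := by
    have hq : (max (|W.c₄| ^ 3) (|W.c₆| ^ 2) : ℚ) =
        ((max (|W₀.c₄| ^ 3) (|W₀.c₆| ^ 2) : ℤ) : ℚ) := by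
      rw [← cast_integralModelInt_c₄ W, ← cast_integralModelInt_c₆ W]
      push_cast
      rfl
    rw [hq, Rat.cast_intCast]
    have h1 : ((max (|W₀.c₄| ^ 3) (|W₀.c₆| ^ 2) : ℤ) : ℝ) ≤
        ((1729 * max |W₀.Δ| (|W₀.c₄| ^ 3) : ℤ) : ℝ) := by
      exact_mod_cast max_abs_c₄_c₆_le W₀
    have h2 : ((max |W₀.Δ| (|W₀.c₄| ^ 3) : ℤ) : ℝ) ≤ max Cσ 0 * (N : ℝ) ^ (6 + 6 * ε) :=
      hσ.trans (mul_le_mul_of_nonneg_right (le_max_left _ _) (by positivity))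
    calc ((max (|W₀.c₄| ^ 3) (|W₀.c₆| ^ 2) : ℤ) : ℝ)
        ≤ ((1729 * max |W₀.Δ| (|W₀.c₄| ^ 3) : ℤ) : ℝ) := h1
      _ = 1729 * ((max |W₀.Δ| (|W₀.c₄| ^ 3) : ℤ) : ℝ) := by push_cast; ring
      _ ≤ 1729 * (max Cσ 0 * (N : ℝ) ^ (6 + 6 * ε)) :=
          mul_le_mul_of_nonneg_left h2 (by norm_num)
      _ = 1729 * max Cσ 0 * (N : ℝ) ^ (6 + 6 * ε) := by ring
  -- Silverman: `covol^{-6} ≤ A · max(|c₄|³,|c₆|²) ≤ B · (N^{1+ε})⁶`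
  have hpow : (N : ℝ) ^ (6 + 6 * ε) = ((N : ℝ) ^ (1 + ε)) ^ 6 := by
    rw [← Real.rpow_natCast, ← Real.rpow_mul hNpos.le]
    congr 1
    push_cast
    ring
  have h6 : ZLattice.covolume D.L.lattice ^ (-(6 : ℝ)) ≤ B * ((N : ℝ) ^ (1 + ε)) ^ 6 := by
    calc ZLattice.covolume D.L.lattice ^ (-(6 : ℝ))
        ≤ A * ((max (|W.c₄| ^ 3) (|W.c₆| ^ 2) : ℚ) : ℝ) := hSil W D.L D.isNeronLattice
      _ ≤ A * (1729 * max Cσ 0 * (N : ℝ) ^ (6 + 6 * ε)) := mul_le_mul_of_nonneg_left hmax hA.le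
      _ = B * ((N : ℝ) ^ (1 + ε)) ^ 6 := by rw [hB, hpow]; ring
  have hinv := inv_le_of_rpow_neg_six_le hcov hB0 (by positivity) h6
  -- the degree bound, Manin constant kept (`|c| ≤ |c|`)
  have hdeg := deg_le_of_zagier_of_upper hcov hZ le_rfl hP0 hP hinv
  have hexp : (N : ℝ) ^ (1 + θ) * (N : ℝ) ^ (1 + ε) = (N : ℝ) ^ (2 + θ + ε) := by
    rw [← Real.rpow_add hNpos]; congr 1; ring
  have hsq : |(D.c : ℝ)| ^ 2 = (D.maninConstant : ℝ) ^ 2 := sq_abs _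
  -- assemble
  calc (D.modularDegree : ℝ) = (D.deg : ℝ) := rfl
    _ ≤ 4 * Real.pi ^ 2 * |(D.c : ℝ)| ^ 2 * (max C₂ 0 * (N : ℝ) ^ (1 + θ)) *
          (B ^ (1 / 6 : ℝ) * (N : ℝ) ^ (1 + ε)) := hdeg
    _ = K * |(D.c : ℝ)| ^ 2 * ((N : ℝ) ^ (1 + θ) * (N : ℝ) ^ (1 + ε)) := by rw [hK]; ring
    _ = K * (D.maninConstant : ℝ) ^ 2 * (N : ℝ) ^ (2 + θ + ε) := by rw [hexp, hsq]

/-- **The `ε`-form for every elliptic curve over `ℚ`**: if `(f,f) ≪_η N^{1+η}` for every `η > 0`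
(Murty's "`log (f,f) < (1+ε) log N`"), then abc gives `deg φ_D ≤ C_ε · c_D² · N^{2+ε}` for every
datum `D` of every elliptic curve over `ℚ` in global minimal form, at the level of its conductor.
[cite: MurtyCongruencePrimes1999, Thm. 1 (ii) and §2] -/
theorem modularDegree_le_maninSq_of_abcLe_of_petersson_of_isGloballyMinimal
    (hUp : ∀ η : ℝ, 0 < η → ∃ C₂ : ℝ, ∀ (N : ℕ) [NeZero N] (W : WeierstrassCurve ℚ) [W.IsElliptic]
      (f : CuspForm (Gamma0 N) 2), IsNewformOf W f →
        (peterssonProduct (Gamma0 N) 2 f f).re ≤ C₂ * (N : ℝ) ^ (1 + η))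
    (habc : ∀ ε : ℝ, 0 < ε → ∃ C : ℝ, ∀ a b c : ℕ, DiophantineGeometry.IsABCTriple a b c →
      (c : ℝ) ≤ C * ((DiophantineGeometry.rad a b c : ℕ) : ℝ) ^ (1 + ε)) :
    ∀ ε : ℝ, 0 < ε → ∃ C : ℝ, ∀ (W : WeierstrassCurve ℚ) [W.IsElliptic] [W.IsGloballyMinimal]
      (N : ℕ) [NeZero N], W.conductorNorm ℤ = N →
        ∀ D : ModularParametrizationData W N,
          (D.modularDegree : ℝ) ≤ C * (D.maninConstant : ℝ) ^ 2 * (N : ℝ) ^ (2 + ε) := by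
  intro ε hε
  have hε2 : 0 < ε / 2 := half_pos hε
  obtain ⟨C, hC⟩ := modularDegree_le_maninSq_rpow_of_abcLe_of_petersson_of_isGloballyMinimal
    (hUp (ε / 2) hε2) habc (ε / 2) hε2
  refine ⟨C, fun W _ _ N _ hN D ↦ ?_⟩
  have h := hC W N hN D
  rwa [show 2 + ε / 2 + ε / 2 = 2 + ε by ring] at h

/-- **abc alone bounds the modular degree of semistable curves up to the Manin constant.** For
SEMISTABLE elliptic curves over `ℚ` (square-free conductor) the Petersson upper bound is a theorem
of the tree — `(f,f) ≤ C · N · (1 + log N)⁵` for the newform of an elliptic curve at square-free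
level `N` (`Literature.NumberTheory.Automorphic.exists_petersson_le_mul_log_pow_of_squarefree`,
the printed Phragmén–Lindelöf argument on the tree's Rankin–Selberg continuation) — so the `≤`-form
of the abc conjecture alone gives, for every `ε > 0`, a `C` with
`deg φ_D ≤ C · c_D² · N_W^{2+ε}` for every semistable elliptic `W/ℚ` in global minimal form and
every datum `D` of `W` at level `N_W`. With `|c_D|` bounded for some datum of each such `W`
(modularity; Edixhoven 1991; Mazur 1978, Abbes–Ullmo 1996, Česnavičius 2018 for the optimal curve;
Mazur–Kenku inside the class) this is the modular-degree conjecture for semistable curves, i.e.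
Murty's direction (ii) beyond Frey curves; the Manin input is exactly what is not supplied here
(Pasten 2024, Rem. 3.3). [cite: MurtyCongruencePrimes1999, Thm. 1 (ii) and §2]
[cite: PastenShimura2024, Rem. 3.3] -/
theorem modularDegree_le_maninSq_of_abcLe_of_isSemistable
    (habc : ∀ ε : ℝ, 0 < ε → ∃ C : ℝ, ∀ a b c : ℕ, DiophantineGeometry.IsABCTriple a b c →
      (c : ℝ) ≤ C * ((DiophantineGeometry.rad a b c : ℕ) : ℝ) ^ (1 + ε)) :
    ∀ ε : ℝ, 0 < ε → ∃ C : ℝ, ∀ (W : WeierstrassCurve ℚ) [W.IsElliptic] [W.IsGloballyMinimal]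
      [NeZero (W.conductorNorm ℤ)], W.IsSemistable ℤ →
        ∀ D : ModularParametrizationData W (W.conductorNorm ℤ),
          (D.modularDegree : ℝ) ≤
            C * (D.maninConstant : ℝ) ^ 2 * (W.conductorNorm ℤ : ℝ) ^ (2 + ε) := by
  intro ε hε
  have hε2 : 0 < ε / 2 := half_pos hε
  -- abc ⟹ generalised Szpiro with exponent `6 + 3ε`
  have h3ε : 0 < 6 * (ε / 2) := by positivity
  obtain ⟨Cσ, hCσ⟩ := abcLe_iff_generalizedSzpiroBG_holds.mp habc (6 * (ε / 2)) h3ε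
  obtain ⟨A, hA, hSil⟩ := covolume_rpow_neg_six_le_of_isNeronLatticeOf
  obtain ⟨CP, hCP, hPet⟩ := Automorphic.exists_petersson_le_mul_log_pow_of_squarefree
  -- the constant
  set B : ℝ := A * (1729 * max Cσ 0) with hB
  have hB0 : 0 ≤ B := by positivity
  set C₂ : ℝ := CP * (5 / (ε / 2) + 1) ^ 5 with hC₂
  have hC₂0 : 0 ≤ C₂ := by positivity
  set K : ℝ := 4 * Real.pi ^ 2 * C₂ * B ^ (1 / 6 : ℝ) with hK
  refine ⟨K, fun W _ _ _ hss D ↦ ?_⟩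
  set N : ℕ := W.conductorNorm ℤ with hNdef
  have hNpos : (0 : ℝ) < N := by exact_mod_cast Nat.pos_of_ne_zero (NeZero.ne N)
  have hN1 : (1 : ℝ) ≤ N := by exact_mod_cast Nat.pos_of_ne_zero (NeZero.ne N)
  have hsq : Squarefree N := (W.isSemistable_iff_squarefree_conductorNorm).mp hss
  -- Zagier's identity `4π² c² (f,f) = deg · covol`
  have hZ := congrArg Complex.re D.zagier_degree_formula_holds
  rw [Complex.re_ofReal_mul, Complex.ofReal_re] at hZ
  have hP0 : 0 ≤ (peterssonProduct (Gamma0 N) 2 D.f D.f).re :=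
    D.zagier_degree_formula_holds.peterssonProduct_re_pos.le
  have hcov : 0 < ZLattice.covolume D.L.lattice := ZLattice.covolume_pos _ _
  -- the Petersson upper bound at square-free level: `(f,f) ≤ CP · N (1 + log N)⁵ ≤ C₂ N^{1+ε/2}`
  have hP : (peterssonProduct (Gamma0 N) 2 D.f D.f).re ≤ C₂ * (N : ℝ) ^ (1 + ε / 2) := by
    have h1 := hPet N hsq W D.f D.isNewformOf
    have hlog : (1 + Real.log N) ^ 5 ≤ (5 / (ε / 2) + 1) ^ 5 * (N : ℝ) ^ (ε / 2) := by
      rw [add_comm]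
      exact log_add_one_pow_five_le hN1 hε2
    have hNrpow : (N : ℝ) * (N : ℝ) ^ (ε / 2) = (N : ℝ) ^ (1 + ε / 2) := by
      rw [Real.rpow_add hNpos, Real.rpow_one]
    calc (peterssonProduct (Gamma0 N) 2 D.f D.f).re ≤ CP * N * (1 + Real.log N) ^ 5 := h1
      _ ≤ CP * N * ((5 / (ε / 2) + 1) ^ 5 * (N : ℝ) ^ (ε / 2)) :=
          mul_le_mul_of_nonneg_left hlog (by positivity)
      _ = C₂ * ((N : ℝ) * (N : ℝ) ^ (ε / 2)) := by rw [hC₂]; ring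
      _ = C₂ * (N : ℝ) ^ (1 + ε / 2) := by rw [hNrpow]
  -- generalised Szpiro on the integral global minimal model `W₀`, `W₀ ⊗ ℚ = W`
  set W₀ : WeierstrassCurve ℤ := integralModelInt W with hW₀def
  have hW₀ : W₀.baseChange ℚ = W := baseChange_integralModelInt W
  have hell : (W₀.baseChange ℚ).IsElliptic := by rw [hW₀]; infer_instance
  have hmin : ∀ v : HeightOneSpectrum ℤ, (W₀.baseChange ℚ).IsMinimalAt v := fun v ↦ by
    rw [hW₀]; exact IsGloballyMinimal.isMinimalAt_int W v
  have hσ := hCσ W₀ hell hmin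
  rw [hW₀] at hσ
  -- `max(|c₄|³,|c₆|²) ≤ 1729 · max(|Δ|,|c₄|³) ≤ 1729 · max Cσ 0 · N^{6+3ε}`
  have hmax : ((max (|W.c₄| ^ 3) (|W.c₆| ^ 2) : ℚ) : ℝ) ≤
      1729 * max Cσ 0 * (N : ℝ) ^ (6 + 6 * (ε / 2)) := by
    have hq : (max (|W.c₄| ^ 3) (|W.c₆| ^ 2) : ℚ) =
        ((max (|W₀.c₄| ^ 3) (|W₀.c₆| ^ 2) : ℤ) : ℚ) := by
      rw [← cast_integralModelInt_c₄ W, ← cast_integralModelInt_c₆ W]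
      push_cast
      rfl
    rw [hq, Rat.cast_intCast]
    have h1 : ((max (|W₀.c₄| ^ 3) (|W₀.c₆| ^ 2) : ℤ) : ℝ) ≤
        ((1729 * max |W₀.Δ| (|W₀.c₄| ^ 3) : ℤ) : ℝ) := by
      exact_mod_cast max_abs_c₄_c₆_le W₀
    have h2 : ((max |W₀.Δ| (|W₀.c₄| ^ 3) : ℤ) : ℝ) ≤ max Cσ 0 * (N : ℝ) ^ (6 + 6 * (ε / 2)) :=
      hσ.trans (mul_le_mul_of_nonneg_right (le_max_left _ _) (by positivity))
    calc ((max (|W₀.c₄| ^ 3) (|W₀.c₆| ^ 2) : ℤ) : ℝ)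
        ≤ ((1729 * max |W₀.Δ| (|W₀.c₄| ^ 3) : ℤ) : ℝ) := h1
      _ = 1729 * ((max |W₀.Δ| (|W₀.c₄| ^ 3) : ℤ) : ℝ) := by push_cast; ring
      _ ≤ 1729 * (max Cσ 0 * (N : ℝ) ^ (6 + 6 * (ε / 2))) :=
          mul_le_mul_of_nonneg_left h2 (by norm_num)
      _ = 1729 * max Cσ 0 * (N : ℝ) ^ (6 + 6 * (ε / 2)) := by ring
  -- Silverman: `covol^{-6} ≤ A · max(|c₄|³,|c₆|²) ≤ B · (N^{1+ε/2})⁶`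
  have hpow : (N : ℝ) ^ (6 + 6 * (ε / 2)) = ((N : ℝ) ^ (1 + ε / 2)) ^ 6 := by
    rw [← Real.rpow_natCast, ← Real.rpow_mul hNpos.le]
    congr 1
    push_cast
    ring
  have h6 : ZLattice.covolume D.L.lattice ^ (-(6 : ℝ)) ≤ B * ((N : ℝ) ^ (1 + ε / 2)) ^ 6 := by
    calc ZLattice.covolume D.L.lattice ^ (-(6 : ℝ))
        ≤ A * ((max (|W.c₄| ^ 3) (|W.c₆| ^ 2) : ℚ) : ℝ) := hSil W D.L D.isNeronLattice
      _ ≤ A * (1729 * max Cσ 0 * (N : ℝ) ^ (6 + 6 * (ε / 2))) :=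
          mul_le_mul_of_nonneg_left hmax hA.le
      _ = B * ((N : ℝ) ^ (1 + ε / 2)) ^ 6 := by rw [hB, hpow]; ring
  have hinv := inv_le_of_rpow_neg_six_le hcov hB0 (by positivity) h6
  -- the degree bound, Manin constant kept (`|c| ≤ |c|`)
  have hdeg := deg_le_of_zagier_of_upper hcov hZ le_rfl hP0 hP hinv
  have hexp : (N : ℝ) ^ (1 + ε / 2) * (N : ℝ) ^ (1 + ε / 2) = (N : ℝ) ^ (2 + ε) := by
    rw [← Real.rpow_add hNpos]; congr 1; ring
  have hsqc : |(D.c : ℝ)| ^ 2 = (D.maninConstant : ℝ) ^ 2 := sq_abs _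
  -- assemble
  calc (D.modularDegree : ℝ) = (D.deg : ℝ) := rfl
    _ ≤ 4 * Real.pi ^ 2 * |(D.c : ℝ)| ^ 2 * (C₂ * (N : ℝ) ^ (1 + ε / 2)) *
          (B ^ (1 / 6 : ℝ) * (N : ℝ) ^ (1 + ε / 2)) := hdeg
    _ = K * |(D.c : ℝ)| ^ 2 * ((N : ℝ) ^ (1 + ε / 2) * (N : ℝ) ^ (1 + ε / 2)) := by
          rw [hK]; ring
    _ = K * (D.maninConstant : ℝ) ^ 2 * (N : ℝ) ^ (2 + ε) := by rw [hexp, hsqc]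

/-- **Free-level form of `modularDegree_le_maninSq_of_abcLe_of_isSemistable`** (the level `N` of
the datum as a variable with `N_W = N`, the shape in which data produced by other statements —
optimal data, data of isogenous curves — are consumed without transport along `N_W = N`): the
`≤`-form of abc gives, for every `ε > 0`, a `C` with `deg φ_D ≤ C · c_D² · N^{2+ε}` for every
semistable elliptic `W/ℚ` in global minimal form, every level `N = N_W` and every datum `D` of `W`
at level `N`. [cite: MurtyCongruencePrimes1999, Thm. 1 (ii) and §2] -/
theorem modularDegree_le_maninSq_of_abcLe_of_isSemistable'
    (habc : ∀ ε : ℝ, 0 < ε → ∃ C : ℝ, ∀ a b c : ℕ, DiophantineGeometry.IsABCTriple a b c →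
      (c : ℝ) ≤ C * ((DiophantineGeometry.rad a b c : ℕ) : ℝ) ^ (1 + ε)) :
    ∀ ε : ℝ, 0 < ε → ∃ C : ℝ, ∀ (W : WeierstrassCurve ℚ) [W.IsElliptic] [W.IsGloballyMinimal]
      (N : ℕ) [NeZero N], W.conductorNorm ℤ = N → W.IsSemistable ℤ →
        ∀ D : ModularParametrizationData W N,
          (D.modularDegree : ℝ) ≤ C * (D.maninConstant : ℝ) ^ 2 * (N : ℝ) ^ (2 + ε) := by
  intro ε hε
  obtain ⟨C, hC⟩ := modularDegree_le_maninSq_of_abcLe_of_isSemistable habc ε hε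
  refine ⟨C, fun W _ _ N _ hN hss D ↦ ?_⟩
  subst hN
  exact hC W hss D

end Literature.NumberTheory.EllipticCurves

end
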